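import Literature.Analysis.FluidPDE.ForcedHeatDuhamelHolder
import HarnessLib

/-!
# Calculus in the one-constant Hölder classes `IsHolderField k α A`

Analysis/FluidPDE support file (everything proved, no definitions, no named facts) for the
discharge of the named fact `Literature.Analysis.FluidPDE.jia_sverak_2014_local_higher_regularity`
(`JiaSverak2014LocalRegularity.lean`; H. Jia, V. Šverák, Invent. Math. 196 (2014) =
arXiv:1204.0529, §4, proof of Thm. 4.1: "we can apply Theorem 3.1 and some simple bootstrapping
arguments to conclude"). The bootstrapping runs in the classes `IsHolderField k α A a`
(`OseenSliceHolder.lean`: `a ∈ Cᵏ`, `‖Dʲa‖ ≤ A` for `j ≤ k`, `[Dᵏa]_α ≤ A`), and needs the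
elementary closure properties of these classes recorded here (Gilbarg–Trudinger 2001, §4.1,
the algebra properties of `C^{k,α}`):

* `IsHolderField.norm_iteratedFDeriv_sub_le` — all derivatives of order `≤ k` are `α`-Hölder
  with constant `2A` (`0 ≤ α ≤ 1`);
* `IsHolderField.comp_add_right`, `IsHolderField.comp_sub_right` — translation invariance;
* `norm_iteratedFDeriv_smul_le_of_bounds` — Leibniz bound `‖Dʲ(f g)‖ ≤ 2ʲ A B`;
* `IsHolderField.smul` — **products**: `f ∈ C^{k,α}` (scalar, constant `A`), `g ∈ C^{k,α}`
  (constant `B`) give `f g ∈ C^{k,α}` with constant `2^{k+2} A B` (the Hölder seminorm of the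
  top derivative through finite differences of translates, no Leibniz formula needed);
* `IsHolderField.clm_comp_left` — post-composition with a continuous linear map;
* `IsHolderField.fderiv_right`, `IsHolderField.of_fderiv_right` — `a ∈ C^{k+1,α}` iff `a` is
  differentiable, bounded, with `Da ∈ C^{k,α}` (same constant);
* `IsCkBounded.isHolderField_of_succ`, `isHolderField_of_contDiff_of_hasCompactSupport` —
  `C^{k+1}`-bounded data are `C^{k,α}`, smooth compactly supported functions are `C^{k,α}` for
  every `k`;
* `IsHolderField.holderWith` — bridge to Mathlib's `HolderWith`;
* `isHolderField_zero_smul_of_holderOn` — a datum bounded and `α`-Hölder on a set `S` times a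
  bounded Lipschitz cut-off vanishing off `S` is globally `C^{0,α}` (the localisation `ηu` of
  Jia–Šverák's proof of Thm. 3.2);
* `IsHolderField.smul_of_contDiff` — a `C^{k+1}` function with bounded derivatives **on a
  neighbourhood of the support** of a `C^{k+1}`-bounded cut-off gives a `C^{k,α}` product.

## Mathlib / tree search

Mathlib (used): `norm_iteratedFDeriv_smul_le`, `Nat.sum_range_choose`,
`iteratedFDeriv_comp_add_right`, `iteratedFDeriv_comp_sub`, `iteratedFDeriv_sub`,
`ContinuousLinearMap.iteratedFDeriv_comp_left`, `iteratedFDeriv_succ_eq_comp_right`,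
`norm_iteratedFDeriv_fderiv`, `contDiff_succ_iff_fderiv`, `tsupport_iteratedFDeriv_subset`,
`HolderWith`. Tree: `IsHolderField`, `IsCkBounded`, `IsHolderField.of_succ`,
`IsHolderField.fderiv_apply` (`OseenSliceHolder`), `IsHolderField.add/neg/sub/sum/mono_const`
(`ForcedHeatDuhamelHolder`).

## References

* H. Jia, V. Šverák, Invent. Math. 196 (2014) = arXiv:1204.0529, §4 proof of Thm. 4.1.
  Bib key `JiaSverak2014`.
* D. Gilbarg, N. S. Trudinger, *Elliptic Partial Differential Equations of Second Order*
  (2001), §4.1. Bib key `GilbargTrudinger2001`.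
-/

noncomputable section

open Set Function Filter Metric
open _root_.Topology
open scoped NNReal ENNReal ContDiff

namespace Literature.Analysis.FluidPDE

variable {E : Type*} [NormedAddCommGroup E] [NormedSpace ℝ E]
variable {F : Type*} [NormedAddCommGroup F] [NormedSpace ℝ F]
variable {G : Type*} [NormedAddCommGroup G] [NormedSpace ℝ G]
variable {k : ℕ} {α A B : ℝ}

/-! ### All derivatives are Hölder; translation invariance -/

/-- `min(A r, 2A) ≤ 2A r^α` for `0 ≤ α ≤ 1`, `0 ≤ A`, `0 ≤ r`: the elementary inequality turning a
Lipschitz-and-bounded estimate into a Hölder one. [folklore] -/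
theorem le_two_mul_rpow_of_le_mul_of_le {d A r : ℝ} (hA : 0 ≤ A) (hr : 0 ≤ r) (hα0 : 0 ≤ α)
    (hα1 : α ≤ 1) (h1 : d ≤ A * r) (h2 : d ≤ 2 * A) : d ≤ 2 * A * r ^ α := by
  rcases le_or_gt r 1 with hr1 | hr1
  · calc d ≤ A * r := h1
      _ ≤ A * r ^ α := by
          refine mul_le_mul_of_nonneg_left ?_ hA
          conv_lhs => rw [← Real.rpow_one r]
          exact Real.rpow_le_rpow_of_exponent_ge' hr hr1 hα0 hα1
      _ ≤ 2 * A * r ^ α := by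
          have : 0 ≤ A * r ^ α := mul_nonneg hA (Real.rpow_nonneg hr _)
          linarith
  · calc d ≤ 2 * A := h2
      _ ≤ 2 * A * r ^ α := le_mul_of_one_le_right (by linarith) (Real.one_le_rpow hr1.le hα0)

/-- **All derivatives of order `≤ k` of `C^{k,α}` data are `α`-Hölder with constant `2A`**
(`0 ≤ α ≤ 1`): the top one by hypothesis, the lower ones being `A`-Lipschitz and bounded by `A`.
[folklore] -/
theorem IsHolderField.norm_iteratedFDeriv_sub_le {a : E → F} (h : IsHolderField k α A a)
    (hα0 : 0 ≤ α) (hα1 : α ≤ 1) {j : ℕ} (hj : j ≤ k) (x y : E) :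
    ‖iteratedFDeriv ℝ j a x - iteratedFDeriv ℝ j a y‖ ≤ 2 * A * ‖x - y‖ ^ α := by
  have hA := h.nonneg
  rcases hj.lt_or_eq with hlt | rfl
  · -- Lipschitz bound from the mean value inequality
    have hdiff : Differentiable ℝ (iteratedFDeriv ℝ j a) :=
      h.contDiff.differentiable_iteratedFDeriv (by exact_mod_cast hlt)
    have hlip : ‖iteratedFDeriv ℝ j a x - iteratedFDeriv ℝ j a y‖ ≤ A * ‖x - y‖ := by
      refine Convex.norm_image_sub_le_of_norm_fderiv_le (s := univ) (fun z _ => hdiff z)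
        (fun z _ => ?_) convex_univ (mem_univ y) (mem_univ x)
      rw [norm_fderiv_iteratedFDeriv]
      exact h.norm_le (j + 1) hlt z
    have hbd : ‖iteratedFDeriv ℝ j a x - iteratedFDeriv ℝ j a y‖ ≤ 2 * A :=
      (_root_.norm_sub_le _ _).trans (by linarith [h.norm_le j hj x, h.norm_le j hj y])
    exact le_two_mul_rpow_of_le_mul_of_le hA (norm_nonneg _) hα0 hα1 hlip hbd
  · calc ‖iteratedFDeriv ℝ j a x - iteratedFDeriv ℝ j a y‖ ≤ A * ‖x - y‖ ^ α := h.holder x y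
      _ ≤ 2 * A * ‖x - y‖ ^ α := by
          have : 0 ≤ A * ‖x - y‖ ^ α := mul_nonneg hA (Real.rpow_nonneg (norm_nonneg _) _)
          linarith

/-- **Translation invariance**: `x ↦ a(x + v)` is `C^{k,α}` with the same constant. [folklore] -/
theorem IsHolderField.comp_add_right {a : E → F} (h : IsHolderField k α A a) (v : E) :
    IsHolderField k α A fun x => a (x + v) := by
  refine ⟨h.contDiff.comp (contDiff_id.add contDiff_const), fun j hj x => ?_, fun x y => ?_⟩
  · rw [iteratedFDeriv_comp_add_right]
    exact h.norm_le j hj (x + v)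
  · rw [iteratedFDeriv_comp_add_right, iteratedFDeriv_comp_add_right]
    have := h.holder (x + v) (y + v)
    rwa [show x + v - (y + v) = x - y by abel] at this

/-- **Translation invariance**: `x ↦ a(x - v)` is `C^{k,α}` with the same constant. [folklore] -/
theorem IsHolderField.comp_sub_right {a : E → F} (h : IsHolderField k α A a) (v : E) :
    IsHolderField k α A fun x => a (x - v) := by
  simpa [sub_eq_add_neg] using h.comp_add_right (-v)

/-- **Finite differences of translates**: all derivatives of order `≤ k` of `a - a(· + v)` are
bounded by `2A‖v‖^α`. [folklore] -/
theorem IsHolderField.norm_iteratedFDeriv_sub_translate_le {a : E → F} (h : IsHolderField k α A a)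
    (hα0 : 0 ≤ α) (hα1 : α ≤ 1) (v : E) {j : ℕ} (hj : j ≤ k) (x : E) :
    ‖iteratedFDeriv ℝ j (fun y => a y - a (y + v)) x‖ ≤ 2 * A * ‖v‖ ^ α := by
  have hcj : ContDiff ℝ j a := h.contDiff.of_le (by exact_mod_cast hj)
  have hcj' : ContDiff ℝ j fun y => a (y + v) := hcj.comp (contDiff_id.add contDiff_const)
  have hs := congrFun (iteratedFDeriv_sub hcj hcj') x
  rw [Pi.sub_apply] at hs
  rw [show (fun y => a y - a (y + v)) = a - fun y => a (y + v) from rfl, hs,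
    iteratedFDeriv_comp_add_right]
  have := h.norm_iteratedFDeriv_sub_le hα0 hα1 hj x (x + v)
  rwa [show x - (x + v) = -v by abel, norm_neg] at this

/-! ### Products -/

/-- **Leibniz bound with constants**: if `f` (scalar) and `g` are `Cᵏ` with all derivatives of
order `≤ k` bounded by `A ≥ 0`, `B`, then `‖Dʲ(f g)(x)‖ ≤ 2ʲ A B` for `j ≤ k`
(Mathlib's `norm_iteratedFDeriv_smul_le` and `Σᵢ C(j,i) = 2ʲ`). [folklore] -/
theorem norm_iteratedFDeriv_smul_le_of_bounds {f : E → ℝ} {g : E → F} (hf : ContDiff ℝ k f)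
    (hg : ContDiff ℝ k g) (hA0 : 0 ≤ A)
    (hA : ∀ i ≤ k, ∀ z, ‖iteratedFDeriv ℝ i f z‖ ≤ A) (hB : ∀ i ≤ k, ∀ z, ‖iteratedFDeriv ℝ i g z‖ ≤ B)
    {j : ℕ} (hj : j ≤ k) (x : E) :
    ‖iteratedFDeriv ℝ j (fun y => f y • g y) x‖ ≤ 2 ^ j * A * B := by
  have h1 := norm_iteratedFDeriv_smul_le hf hg x (n := j) (by exact_mod_cast hj)
  refine h1.trans ?_
  calc ∑ i ∈ Finset.range (j + 1),
        (j.choose i : ℝ) * ‖iteratedFDeriv ℝ i f x‖ * ‖iteratedFDeriv ℝ (j - i) g x‖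
      ≤ ∑ i ∈ Finset.range (j + 1), (j.choose i : ℝ) * A * B := by
        refine Finset.sum_le_sum fun i hi => ?_
        have hij : i ≤ j := Nat.lt_succ_iff.1 (Finset.mem_range.1 hi)
        have e1 := hA i (hij.trans hj) x
        have e2 := hB (j - i) ((Nat.sub_le j i).trans hj) x
        have hc : (0 : ℝ) ≤ (j.choose i : ℝ) := Nat.cast_nonneg _
        exact mul_le_mul (mul_le_mul_of_nonneg_left e1 hc) e2 (norm_nonneg _) (by positivity)
    _ = 2 ^ j * A * B := by
        rw [← Finset.sum_mul, ← Finset.sum_mul]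
        congr 1; congr 1
        have := Nat.sum_range_choose j
        exact_mod_cast this

/-- **Products of Hölder fields** (Gilbarg–Trudinger §4.1: `C^{k,α}` is an algebra): if `f` is a
scalar `C^{k,α}` field with constant `A` and `g` a `C^{k,α}` field with constant `B`
(`0 ≤ α ≤ 1`), then `f g` is `C^{k,α}` with constant `2^{k+2} A B`. The bounds are the Leibniz
bound; the Hölder seminorm of `Dᵏ(fg)` is estimated through the finite difference
`Dᵏ(fg)(x) − Dᵏ(fg)(x+v) = Dᵏ[(f − f(·+v)) g + f(·+v) (g − g(·+v))](x)`, each factor in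
brackets being `Cᵏ`-bounded by `2A‖v‖^α`, resp. `2B‖v‖^α`. [cite: GilbargTrudinger2001, §4.1 (4.7)] -/
theorem IsHolderField.smul {f : E → ℝ} {g : E → F} (hf : IsHolderField k α A f)
    (hg : IsHolderField k α B g) (hα0 : 0 ≤ α) (hα1 : α ≤ 1) :
    IsHolderField k α (2 ^ (k + 2) * A * B) fun x => f x • g x := by
  have hA := hf.nonneg
  have hB := hg.nonneg
  have h2k : (1 : ℝ) ≤ 2 ^ k := one_le_pow₀ (by norm_num)
  refine ⟨hf.contDiff.smul hg.contDiff, fun j hj x => ?_, fun x y => ?_⟩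
  · calc ‖iteratedFDeriv ℝ j (fun y => f y • g y) x‖ ≤ 2 ^ j * A * B :=
          norm_iteratedFDeriv_smul_le_of_bounds hf.contDiff hg.contDiff hA hf.norm_le hg.norm_le hj x
      _ ≤ 2 ^ (k + 2) * A * B := by
          have : (2 : ℝ) ^ j ≤ 2 ^ (k + 2) := pow_le_pow_right₀ (by norm_num) (by omega)
          gcongr
  · -- the finite difference of translates
    set v : E := y - x with hv
    have hyv : y = x + v := by rw [hv]; abel
    set f' : E → ℝ := fun z => f (z + v) with hf'
    set g' : E → F := fun z => g (z + v) with hg'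
    have hf'H : IsHolderField k α A f' := hf.comp_add_right v
    have hcf : ContDiff ℝ k f := hf.contDiff
    have hcg : ContDiff ℝ k g := hg.contDiff
    have hcf' : ContDiff ℝ k f' := hf'H.contDiff
    have hcg' : ContDiff ℝ k g' := (hg.comp_add_right v).contDiff
    -- `Dᵏ(fg)(y) = Dᵏ(f' g')(x)`
    have htr : iteratedFDeriv ℝ k (fun z => f z • g z) y =
        iteratedFDeriv ℝ k (fun z => f' z • g' z) x := by
      rw [hyv]
      exact (iteratedFDeriv_comp_add_right (f := fun z => f z • g z) k v x).symm
    -- the algebraic splitting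
    have hsplit : (fun z => f z • g z) - (fun z => f' z • g' z) =
        (fun z => (f z - f (z + v)) • g z) + fun z => f' z • (g z - g (z + v)) := by
      funext z
      simp only [Pi.sub_apply, Pi.add_apply, hf', hg', sub_smul, smul_sub]
      abel
    have hd1 : ContDiff ℝ k fun z => f z - f (z + v) := hcf.sub hcf'
    have hd2 : ContDiff ℝ k fun z => g z - g (z + v) := hcg.sub hcg'
    have hD : iteratedFDeriv ℝ k (fun z => f z • g z) x - iteratedFDeriv ℝ k (fun z => f' z • g' z) x =
        iteratedFDeriv ℝ k (fun z => (f z - f (z + v)) • g z) x +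
          iteratedFDeriv ℝ k (fun z => f' z • (g z - g (z + v))) x := by
      have e1 : iteratedFDeriv ℝ k ((fun z => f z • g z) - fun z => f' z • g' z) x =
          iteratedFDeriv ℝ k (fun z => f z • g z) x - iteratedFDeriv ℝ k (fun z => f' z • g' z) x :=
        iteratedFDeriv_sub_apply (hcf.smul hcg).contDiffAt (hcf'.smul hcg').contDiffAt
      have e2 : iteratedFDeriv ℝ k ((fun z => (f z - f (z + v)) • g z) + fun z => f' z • (g z - g (z + v))) x =
          iteratedFDeriv ℝ k (fun z => (f z - f (z + v)) • g z) x +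
            iteratedFDeriv ℝ k (fun z => f' z • (g z - g (z + v))) x :=
        iteratedFDeriv_add_apply (hd1.smul hcg).contDiffAt (hcf'.smul hd2).contDiffAt
      rw [← e1, show ((fun z => f z • g z) - fun z => f' z • g' z) =
        (fun z => (f z - f (z + v)) • g z) + fun z => f' z • (g z - g (z + v)) from hsplit, e2]
    -- the two Leibniz bounds
    have hvα : 0 ≤ ‖v‖ ^ α := Real.rpow_nonneg (norm_nonneg _) _
    have e1 : ‖iteratedFDeriv ℝ k (fun z => (f z - f (z + v)) • g z) x‖ ≤
        2 ^ k * (2 * A * ‖v‖ ^ α) * B :=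
      norm_iteratedFDeriv_smul_le_of_bounds hd1 hcg (by positivity)
        (fun i hi z => hf.norm_iteratedFDeriv_sub_translate_le hα0 hα1 v hi z) hg.norm_le le_rfl x
    have e2 : ‖iteratedFDeriv ℝ k (fun z => f' z • (g z - g (z + v))) x‖ ≤
        2 ^ k * A * (2 * B * ‖v‖ ^ α) :=
      norm_iteratedFDeriv_smul_le_of_bounds hcf' hd2 hA hf'H.norm_le
        (fun i hi z => hg.norm_iteratedFDeriv_sub_translate_le hα0 hα1 v hi z) le_rfl x
    rw [htr, hD]
    have hxy : ‖x - y‖ = ‖v‖ := by rw [hv, ← norm_neg]; congr 1; abel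
    rw [hxy]
    calc ‖iteratedFDeriv ℝ k (fun z => (f z - f (z + v)) • g z) x +
          iteratedFDeriv ℝ k (fun z => f' z • (g z - g (z + v))) x‖
        ≤ 2 ^ k * (2 * A * ‖v‖ ^ α) * B + 2 ^ k * A * (2 * B * ‖v‖ ^ α) :=
          (norm_add_le _ _).trans (add_le_add e1 e2)
      _ = 2 ^ (k + 2) * A * B * ‖v‖ ^ α := by ring

/-! ### Post-composition with continuous linear maps -/

/-- **Post-composition with a continuous linear map**: `L ∘ a` is `C^{k,α}` with constant
`‖L‖ A` (`Dʲ(L ∘ a) = L ∘ Dʲa`). [folklore] -/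
theorem IsHolderField.clm_comp_left {a : E → F} (h : IsHolderField k α A a) (L : F →L[ℝ] G) :
    IsHolderField k α (‖L‖ * A) fun x => L (a x) := by
  have hA := h.nonneg
  have hD : ∀ {j : ℕ}, j ≤ k → ∀ x, iteratedFDeriv ℝ j (fun y => L (a y)) x =
      L.compContinuousMultilinearMap (iteratedFDeriv ℝ j a x) := by
    intro j hj x
    exact L.iteratedFDeriv_comp_left (f := a) (h.contDiff.of_le (by exact_mod_cast hj)).contDiffAt
      (i := j) le_rfl
  have hsub : ∀ (j : ℕ) (M M' : E [×j]→L[ℝ] F),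
      L.compContinuousMultilinearMap M - L.compContinuousMultilinearMap M' =
        L.compContinuousMultilinearMap (M - M') := by
    intro j M M'
    ext m
    simp
  refine ⟨L.contDiff.comp h.contDiff, fun j hj x => ?_, fun x y => ?_⟩
  · rw [hD hj]
    exact (L.norm_compContinuousMultilinearMap_le _).trans
      (mul_le_mul_of_nonneg_left (h.norm_le j hj x) (norm_nonneg _))
  · rw [hD le_rfl, hD le_rfl, hsub]
    calc ‖L.compContinuousMultilinearMap (iteratedFDeriv ℝ k a x - iteratedFDeriv ℝ k a y)‖
        ≤ ‖L‖ * ‖iteratedFDeriv ℝ k a x - iteratedFDeriv ℝ k a y‖ :=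
          L.norm_compContinuousMultilinearMap_le _
      _ ≤ ‖L‖ * (A * ‖x - y‖ ^ α) := mul_le_mul_of_nonneg_left (h.holder x y) (norm_nonneg _)
      _ = ‖L‖ * A * ‖x - y‖ ^ α := by ring

/-- **A scalar Hölder field times a constant vector**: `x ↦ f(x) c` is `C^{k,α}` with constant
`‖c‖ A`. [folklore] -/
theorem IsHolderField.smul_const {f : E → ℝ} (hf : IsHolderField k α A f) (c : F) :
    IsHolderField k α (‖c‖ * A) fun x => f x • c := by
  have h := hf.clm_comp_left (ContinuousLinearMap.smulRight (1 : ℝ →L[ℝ] ℝ) c)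
  have hn : ‖ContinuousLinearMap.smulRight (1 : ℝ →L[ℝ] ℝ) c‖ = ‖c‖ := by
    rw [ContinuousLinearMap.norm_smulRight_apply, norm_one, one_mul]
  simpa [hn] using h

/-- **Coordinates of a Hölder field on Euclidean space are Hölder** with the same constant. [folklore] -/
theorem IsHolderField.coord {ι : Type*} [Fintype ι] {a : E → EuclideanSpace ℝ ι}
    (h : IsHolderField k α A a) (i : ι) : IsHolderField k α A fun x => a x i := by
  have h1 := h.clm_comp_left (EuclideanSpace.proj (𝕜 := ℝ) i)
  have hn : ‖(EuclideanSpace.proj (𝕜 := ℝ) i : EuclideanSpace ℝ ι →L[ℝ] ℝ)‖ ≤ 1 := by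
    refine ContinuousLinearMap.opNorm_le_bound _ zero_le_one fun x => ?_
    rw [one_mul]
    exact PiLp.norm_apply_le x i
  have h2 : IsHolderField k α (1 * A) fun x => a x i :=
    h1.mono_const (mul_le_mul_of_nonneg_right hn h.nonneg)
  simpa using h2

/-! ### One derivative up or down -/

/-- **The derivative of a `C^{k+1,α}` field is `C^{k,α}`** (as a field of continuous linear
maps), with the same constant: `‖Dʲ(Da)‖ = ‖Dʲ⁺¹a‖` and the currying isometry. [folklore] -/
theorem IsHolderField.fderiv_right {a : E → F} (h : IsHolderField (k + 1) α A a) :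
    IsHolderField k α A (fderiv ℝ a) := by
  refine ⟨h.contDiff.fderiv_right (m := k) le_rfl, fun j hj x => ?_, fun x y => ?_⟩
  · rw [norm_iteratedFDeriv_fderiv]
    exact h.norm_le (j + 1) (Nat.succ_le_succ hj) x
  · have e : ∀ z, iteratedFDeriv ℝ (k + 1) a z =
        (continuousMultilinearCurryRightEquiv' ℝ k E F).symm (iteratedFDeriv ℝ k (fderiv ℝ a) z) :=
      fun z => iteratedFDeriv_succ_eq_comp_right
    have := h.holder x y
    rw [e x, e y, ← LinearIsometryEquiv.map_sub, LinearIsometryEquiv.norm_map] at this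
    exact this

/-- **A differentiable bounded field whose derivative is `C^{k,α}` is `C^{k+1,α}`**, with the
same constant (`A` bounds `‖a‖` and the `C^{k,α}` data of `Da`). [folklore] -/
theorem IsHolderField.of_fderiv_right [CompleteSpace F] {a : E → F} (hd : Differentiable ℝ a)
    (hD : IsHolderField k α A (fderiv ℝ a)) (h0 : ∀ x, ‖a x‖ ≤ A) :
    IsHolderField (k + 1) α A a := by
  have hc : ContDiff ℝ (k + 1 : ℕ) a := by
    rw [show ((k + 1 : ℕ) : WithTop ℕ∞) = (k : WithTop ℕ∞) + 1 by push_cast; rfl,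
      contDiff_succ_iff_fderiv]
    exact ⟨hd, fun h => absurd h (by exact_mod_cast WithTop.natCast_ne_top k), hD.contDiff⟩
  refine ⟨hc, fun j hj x => ?_, fun x y => ?_⟩
  · rcases j with _ | j
    · rw [norm_iteratedFDeriv_zero]; exact h0 x
    · rw [← norm_iteratedFDeriv_fderiv]
      exact hD.norm_le j (Nat.le_of_succ_le_succ hj) x
  · have e : ∀ z, iteratedFDeriv ℝ (k + 1) a z =
        (continuousMultilinearCurryRightEquiv' ℝ k E F).symm (iteratedFDeriv ℝ k (fderiv ℝ a) z) :=
      fun z => iteratedFDeriv_succ_eq_comp_right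
    rw [e x, e y, ← LinearIsometryEquiv.map_sub, LinearIsometryEquiv.norm_map]
    exact hD.holder x y

/-! ### From `C^{k+1}` bounds to `C^{k,α}` -/

/-- **`C^{k+1}`-bounded data are `C^{k,α}` with constant `2A`** (`0 ≤ α ≤ 1`): `Dᵏa` is
`A`-Lipschitz by the mean value inequality and bounded by `A`. [folklore] -/
theorem IsCkBounded.isHolderField_of_succ {a : E → F} (h : IsCkBounded (k + 1) A a) (hα0 : 0 ≤ α)
    (hα1 : α ≤ 1) : IsHolderField k α (2 * A) a := by
  have hA := h.nonneg
  have hb := h.of_succ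
  refine ⟨hb.contDiff, fun j hj x => (hb.norm_le j hj x).trans (by linarith), fun x y => ?_⟩
  have hdiff : Differentiable ℝ (iteratedFDeriv ℝ k a) :=
    h.contDiff.differentiable_iteratedFDeriv (by exact_mod_cast Nat.lt_succ_self k)
  have hlip : ‖iteratedFDeriv ℝ k a x - iteratedFDeriv ℝ k a y‖ ≤ A * ‖x - y‖ := by
    refine Convex.norm_image_sub_le_of_norm_fderiv_le (s := univ) (fun z _ => hdiff z)
      (fun z _ => ?_) convex_univ (mem_univ y) (mem_univ x)
    rw [norm_fderiv_iteratedFDeriv]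
    exact h.norm_le (k + 1) le_rfl z
  have hbd : ‖iteratedFDeriv ℝ k a x - iteratedFDeriv ℝ k a y‖ ≤ 2 * A :=
    (norm_sub_le _ _).trans (by linarith [h.norm_le k (Nat.le_succ k) x, h.norm_le k (Nat.le_succ k) y])
  exact le_two_mul_rpow_of_le_mul_of_le hA (norm_nonneg _) hα0 hα1 hlip hbd

/-- Translation invariance of `Cᵏ`-bounded data: `x ↦ a(x - v)`. [folklore] -/
theorem IsCkBounded.comp_sub_right {a : E → F} (h : IsCkBounded k A a) (v : E) :
    IsCkBounded k A fun x => a (x - v) := by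
  refine ⟨h.contDiff.comp (contDiff_id.sub contDiff_const), fun j hj x => ?_⟩
  rw [iteratedFDeriv_comp_sub]
  exact h.norm_le j hj (x - v)

/-- **Smooth compactly supported functions are `Cᵏ`-bounded for every `k`** (each derivative
is continuous with compact support; proper source space). [folklore] -/
theorem exists_isCkBounded_of_hasCompactSupport [ProperSpace E] {a : E → F} (ha : ContDiff ℝ ∞ a)
    (hac : HasCompactSupport a) (k : ℕ) : ∃ A, IsCkBounded k A a := by
  -- a bound for each derivative
  have hb : ∀ j : ℕ, ∃ C, ∀ x, ‖iteratedFDeriv ℝ j a x‖ ≤ C := fun j => by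
    have hc : Continuous (iteratedFDeriv ℝ j a) :=
      ha.continuous_iteratedFDeriv (by exact_mod_cast le_top)
    have hcs : HasCompactSupport (iteratedFDeriv ℝ j a) := hac.iteratedFDeriv j
    obtain ⟨C, hC⟩ := hcs.exists_bound_of_continuous hc
    exact ⟨C, hC⟩
  choose C hC using hb
  refine ⟨∑ j ∈ Finset.range (k + 1), max (C j) 0, ⟨contDiff_infty.1 ha k, fun j hj x => ?_⟩⟩
  calc ‖iteratedFDeriv ℝ j a x‖ ≤ max (C j) 0 := (hC j x).trans (le_max_left _ _)
    _ ≤ ∑ i ∈ Finset.range (k + 1), max (C i) 0 :=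
        Finset.single_le_sum (f := fun i => max (C i) 0) (fun i _ => le_max_right _ _)
          (Finset.mem_range.2 (Nat.lt_succ_of_le hj))

/-- **Smooth compactly supported functions are `C^{k,α}` for every `k`** (`0 ≤ α ≤ 1`). [folklore] -/
theorem exists_isHolderField_of_hasCompactSupport [ProperSpace E] {a : E → F} (ha : ContDiff ℝ ∞ a)
    (hac : HasCompactSupport a) (hα0 : 0 ≤ α) (hα1 : α ≤ 1) (k : ℕ) :
    ∃ A, IsHolderField k α A a := by
  obtain ⟨A, hA⟩ := exists_isCkBounded_of_hasCompactSupport ha hac (k + 1)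
  exact ⟨2 * A, hA.isHolderField_of_succ hα0 hα1⟩

/-! ### Bridge to `HolderWith` -/

/-- **A `C^{0,α}` field is `HolderWith`** in Mathlib's sense (constant `A.toNNReal`, exponent
`α.toNNReal`; the tree's `holderWith_of_norm_sub_le`). [folklore] -/
theorem IsHolderField.holderWith {a : E → F} (h : IsHolderField 0 α A a) (hα : 0 ≤ α) :
    HolderWith A.toNNReal α.toNNReal a :=
  holderWith_of_norm_sub_le h.nonneg hα h.norm_sub_le

omit [NormedSpace ℝ E] [NormedSpace ℝ F] in
/-- A field satisfying a Hölder bound with positive exponent is continuous. [folklore] -/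
theorem continuous_of_norm_sub_le_rpow {a : E → F} (hA : 0 ≤ A) (hα : 0 < α)
    (h : ∀ x y, ‖a x - a y‖ ≤ A * ‖x - y‖ ^ α) : Continuous a :=
  (holderWith_of_norm_sub_le hA hα.le h).continuous (Real.toNNReal_pos.2 hα)

/-! ### Localisation: cut-offs times locally regular fields -/

/-- **A bounded, locally `α`-Hölder datum times a bounded Lipschitz cut-off is globally
`C^{0,α}`** (Jia–Šverák 2014, proof of Thm. 3.2: the localised datum `u₀η`, with `u₀ ∈ C^γ(B₂)`
and `η` supported in the ball). Precisely: if `|ζ| ≤ Z`, `|ζ(x) − ζ(y)| ≤ L‖x − y‖`, `ζ = 0` off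
`S`, and `‖U‖ ≤ C`, `‖U(x) − U(y)‖ ≤ C‖x − y‖^α` on `S` (`0 < α ≤ 1`), then `ζU` is `C^{0,α}`
with constant `2(L + Z)C`. [cite: JiaSverak2014, §3 proof of Thm. 3.2 (arXiv p. 9), u₂ = e^{Δt}(u₀η)] -/
theorem isHolderField_zero_smul_of_holderOn {ζ : E → ℝ} {U : E → F} {S : Set E} {Z L C : ℝ}
    (hZ : 0 ≤ Z) (hL : 0 ≤ L) (hC : 0 ≤ C) (hα0 : 0 < α) (hα1 : α ≤ 1)
    (hζb : ∀ x, |ζ x| ≤ Z) (hζL : ∀ x y, |ζ x - ζ y| ≤ L * ‖x - y‖) (hζS : ∀ x ∉ S, ζ x = 0)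
    (hUb : ∀ x ∈ S, ‖U x‖ ≤ C) (hUH : ∀ x ∈ S, ∀ y ∈ S, ‖U x - U y‖ ≤ C * ‖x - y‖ ^ α) :
    IsHolderField 0 α (2 * (L + Z) * C) fun x => ζ x • U x := by
  -- the global Hölder estimate
  have hsup : ∀ x, ‖ζ x • U x‖ ≤ Z * C := fun x => by
    by_cases hx : x ∈ S
    · rw [norm_smul, Real.norm_eq_abs]
      exact mul_le_mul (hζb x) (hUb x hx) (norm_nonneg _) hZ
    · rw [hζS x hx, zero_smul, norm_zero]; positivity
  -- one point in `S`, the other arbitrary: `‖ζx Ux − ζy Uy‖ ≤ (L + Z) C min-type bound`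
  have hone : ∀ x ∈ S, ∀ y, ‖ζ x • U x - ζ y • U y‖ ≤ 2 * (L + Z) * C * ‖x - y‖ ^ α := by
    intro x hx y
    have hr := norm_nonneg (x - y)
    -- Lipschitz-type bound `≤ (L + Z) C ‖x - y‖` when `‖x - y‖ ≤ 1`, and `≤ 2 Z C` always
    have hbdd : ‖ζ x • U x - ζ y • U y‖ ≤ 2 * (Z * C) :=
      (norm_sub_le _ _).trans (by linarith [hsup x, hsup y])
    by_cases hy : y ∈ S
    · -- both in `S`
      have e : ζ x • U x - ζ y • U y = (ζ x - ζ y) • U x + ζ y • (U x - U y) := by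
        rw [sub_smul, smul_sub]; abel
      rcases le_or_gt ‖x - y‖ 1 with h1 | h1
      · have hr1 : ‖x - y‖ ≤ ‖x - y‖ ^ α := by
          conv_lhs => rw [← Real.rpow_one ‖x - y‖]
          exact Real.rpow_le_rpow_of_exponent_ge' hr h1 hα0.le hα1
        calc ‖ζ x • U x - ζ y • U y‖ ≤ ‖(ζ x - ζ y) • U x‖ + ‖ζ y • (U x - U y)‖ := by
              rw [e]; exact norm_add_le _ _
          _ ≤ L * ‖x - y‖ * C + Z * (C * ‖x - y‖ ^ α) := by
              rw [norm_smul, norm_smul, Real.norm_eq_abs, Real.norm_eq_abs]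
              exact add_le_add (mul_le_mul (hζL x y) (hUb x hx) (norm_nonneg _) (by positivity))
                (mul_le_mul (hζb y) (hUH x hx y hy) (norm_nonneg _) hZ)
          _ ≤ L * ‖x - y‖ ^ α * C + Z * (C * ‖x - y‖ ^ α) := by gcongr
          _ ≤ 2 * (L + Z) * C * ‖x - y‖ ^ α := by
              have : 0 ≤ (L + Z) * C * ‖x - y‖ ^ α := by positivity
              nlinarith
      · calc ‖ζ x • U x - ζ y • U y‖ ≤ 2 * (Z * C) := hbdd
          _ ≤ 2 * (Z * C) * ‖x - y‖ ^ α :=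
              le_mul_of_one_le_right (by positivity) (Real.one_le_rpow h1.le hα0.le)
          _ ≤ 2 * (L + Z) * C * ‖x - y‖ ^ α := by
              have : 0 ≤ L * C * ‖x - y‖ ^ α := by positivity
              nlinarith
    · -- `y ∉ S`: `ζ y = 0`
      have hy0 : ζ y = 0 := hζS y hy
      rw [hy0, zero_smul, sub_zero]
      rcases le_or_gt ‖x - y‖ 1 with h1 | h1
      · have hr1 : ‖x - y‖ ≤ ‖x - y‖ ^ α := by
          conv_lhs => rw [← Real.rpow_one ‖x - y‖]
          exact Real.rpow_le_rpow_of_exponent_ge' hr h1 hα0.le hα1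
        calc ‖ζ x • U x‖ = |ζ x - ζ y| * ‖U x‖ := by rw [norm_smul, Real.norm_eq_abs, hy0, sub_zero]
          _ ≤ L * ‖x - y‖ * C := mul_le_mul (hζL x y) (hUb x hx) (norm_nonneg _) (by positivity)
          _ ≤ L * ‖x - y‖ ^ α * C := by gcongr
          _ ≤ 2 * (L + Z) * C * ‖x - y‖ ^ α := by
              have : 0 ≤ (L + Z) * C * ‖x - y‖ ^ α := by positivity
              have : 0 ≤ Z * C * ‖x - y‖ ^ α := by positivity
              nlinarith
      · calc ‖ζ x • U x‖ ≤ Z * C := hsup x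
          _ ≤ Z * C * ‖x - y‖ ^ α :=
              le_mul_of_one_le_right (by positivity) (Real.one_le_rpow h1.le hα0.le)
          _ ≤ 2 * (L + Z) * C * ‖x - y‖ ^ α := by
              have : 0 ≤ (L + Z) * C * ‖x - y‖ ^ α := by positivity
              have : 0 ≤ L * C * ‖x - y‖ ^ α := by positivity
              nlinarith
  have hall : ∀ x y, ‖ζ x • U x - ζ y • U y‖ ≤ 2 * (L + Z) * C * ‖x - y‖ ^ α := by
    intro x y
    by_cases hx : x ∈ S
    · exact hone x hx y
    by_cases hy : y ∈ S
    · have := hone y hy x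
      rw [norm_sub_rev (ζ y • U y), norm_sub_rev y x] at this
      exact this
    · rw [hζS x hx, hζS y hy, zero_smul, zero_smul, sub_zero, norm_zero]
      positivity
  -- continuity from the Hölder estimate
  have hcont : Continuous fun x => ζ x • U x :=
    continuous_of_norm_sub_le_rpow (by positivity) hα0 hall
  refine ⟨contDiff_zero.2 hcont, fun j hj x => ?_, fun x y => ?_⟩
  · obtain rfl : j = 0 := Nat.le_zero.1 hj
    rw [norm_iteratedFDeriv_zero]
    calc ‖ζ x • U x‖ ≤ Z * C := hsup x
      _ ≤ 2 * (L + Z) * C := by nlinarith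
  · rw [iteratedFDeriv_zero_eq_comp, Function.comp_apply, Function.comp_apply,
      ← LinearIsometryEquiv.map_sub, LinearIsometryEquiv.norm_map]
    exact hall x y

/-- **A smooth cut-off times a field with bounded derivatives near the support of the cut-off
is `C^{k,α}`** (`0 ≤ α ≤ 1`): if `θ` is `C^{k+1}`-bounded by `Θ` with `tsupport θ ⊆ S`, and `V`
is `C^{k+1}` with `‖DʲV(x)‖ ≤ B` for `j ≤ k + 1` and `x ∈ S`, then `θV` is `C^{k,α}` with
constant `2^{k+2} Θ B` (Leibniz on `S`, zero off `tsupport θ`, then `C^{k+1} ⊂ C^{k,α}`). [folklore] -/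
theorem IsCkBounded.isHolderField_smul_of_bounds_on {θ : E → ℝ} {V : E → F} {S : Set E} {Θ : ℝ}
    (hθ : IsCkBounded (k + 1) Θ θ) (hθS : tsupport θ ⊆ S) (hV : ContDiff ℝ (k + 1 : ℕ) V)
    (hB0 : 0 ≤ B) (hB : ∀ j ≤ k + 1, ∀ x ∈ S, ‖iteratedFDeriv ℝ j V x‖ ≤ B) (hα0 : 0 ≤ α)
    (hα1 : α ≤ 1) : IsHolderField k α (2 ^ (k + 2) * Θ * B) fun x => θ x • V x := by
  have hΘ := hθ.nonneg
  -- `θ V` is `C^{k+1}`-bounded by `2^{k+1} Θ B`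
  have hCk : IsCkBounded (k + 1) (2 ^ (k + 1) * Θ * B) fun x => θ x • V x := by
    refine ⟨hθ.contDiff.smul hV, fun j hj x => ?_⟩
    by_cases hx : x ∈ tsupport θ
    · have h1 := norm_iteratedFDeriv_smul_le hθ.contDiff hV x (n := j) (by exact_mod_cast hj)
      refine h1.trans ?_
      calc ∑ i ∈ Finset.range (j + 1),
            (j.choose i : ℝ) * ‖iteratedFDeriv ℝ i θ x‖ * ‖iteratedFDeriv ℝ (j - i) V x‖
          ≤ ∑ i ∈ Finset.range (j + 1), (j.choose i : ℝ) * Θ * B := by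
            refine Finset.sum_le_sum fun i hi => ?_
            have hij : i ≤ j := Nat.lt_succ_iff.1 (Finset.mem_range.1 hi)
            have e1 := hθ.norm_le i (hij.trans hj) x
            have e2 := hB (j - i) ((Nat.sub_le j i).trans hj) x (hθS hx)
            have hc : (0 : ℝ) ≤ (j.choose i : ℝ) := Nat.cast_nonneg _
            gcongr
        _ = 2 ^ j * Θ * B := by
            rw [← Finset.sum_mul, ← Finset.sum_mul]
            congr 1; congr 1
            exact_mod_cast Nat.sum_range_choose j
        _ ≤ 2 ^ (k + 1) * Θ * B := by
            have : (2 : ℝ) ^ j ≤ 2 ^ (k + 1) := pow_le_pow_right₀ (by norm_num) hj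
            gcongr
    · -- off `tsupport θ` the product vanishes identically near `x`
      have hts : tsupport (iteratedFDeriv ℝ j fun y => θ y • V y) ⊆ tsupport θ :=
        (tsupport_iteratedFDeriv_subset j).trans (tsupport_smul_subset_left θ V)
      rw [image_eq_zero_of_notMem_tsupport fun h => hx (hts h), norm_zero]
      positivity
  have h := hCk.isHolderField_of_succ hα0 hα1
  convert h using 1
  ring

end Literature.Analysis.FluidPDE

end
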